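import Mathlib
import Summits.BirchSwinnertonDyer.BirchSwinnertonDyer.Theorems.ResidualThetaTransportAtTwoSignedMuSeedAtTwoPlusNonsquareDescentPrimaryPartCount
import HarnessLib

/-!
# Non-square descent — THE CUBIC CLASS-GROUP SPLITTING OVER THE BASE FIELD: for `L/F` cyclic with `Gal(L/F) = ⟨σ⟩`, `σ³ = 1`:
# `#Cl(L)[q] = #Cl(F)[q] · #{c ∈ Cl(L)[q] : c·σc·σ²c = 1}` (`gcd(3,q) = 1`) and `ord_p #Cl(L) = ord_p #Cl(F) + log_p #A^χ` (`p ≠ 3`) — the form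
# «`e_n(M) = e_n(K) + ord₂ #A_n^χ`» consumed by `…GrowthComparison.classicalMuVanishes_of_comparison_with_base` (line `nonsquare-descent`, stub S2) —
# seed crux `SignedMuSeedAtTwoPlus` stmt-BirchSwinnertonDyer-21438 (parent Kμ⁺ `SignedMuVanishingAtTwoPlus` stmt-BirchSwinnertonDyer-20689, route
# ResidualThetaTransportAtTwo), line card `Cruxes/SignedMuSeedAtTwoPlus/Lines/nonsquare-descent.md`

Cell `bsd-wall`, width seat `bsd-wall-rtt-p4-w2` g19 (`--supports`, closes nothing).  THEOREMS ONLY; BSD is not proved by this.  ARITHMETIC (number fields).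

`…CubicClassGroupSplitting` / `…PrimaryPartCount` state the splitting with the fixed field `L^{⟨σ⟩}` (an `IntermediateField`).  When `σ` GENERATES
`Gal(L/F)` (so `L/F` is cyclic of degree `1` or `3`: the card's `M_n/K_n`), that fixed field is `⊥ ≅ F` and the class groups are identified
(`ClassGroup.mulEquiv (RingOfIntegers.mapRingEquiv _)`):

* `natCard_torsion_classGroup_eq_of_ringEquiv` — `#Cl(E₁)[q] = #Cl(E₂)[q]` for `E₁ ≃+* E₂`; `natCard_classGroup_eq_of_ringEquiv`.
* **`card_torsion_classGroup_eq_card_base_mul_card_normKer`** — `#Cl(L)[q] = #Cl(F)[q] · #{c ∈ Cl(L)[q] : c·σc·σ²c = 1}`.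
* **`padicValNat_card_classGroup_eq_base_add`** — `ord_p #Cl(L) = ord_p #Cl(F) + ord_p #{c ∈ Cl(L)[p^N] : c·σc·σ²c = 1}` for `p ≠ 3`, `N ≥` both `ord_p`'s
  («`ord₂ h(M_n) = ord₂ h(K_n) + ord₂ #A_n^χ`»).

[folklore]
-/

set_option autoImplicit false
-- the Theorems namespace of this sub repeats the summit name by design (D-0017 nested layout)
set_option linter.dupNamespace false

namespace Summit.BirchSwinnertonDyer.BirchSwinnertonDyer.Theorems.SignedMuAtTwo.NonsquareDescent

open NumberField IntermediateField Literature.NumberTheory.NumberFields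

/-- `#Cl(E₁)[q] = #Cl(E₂)[q]` for isomorphic number fields. [folklore] -/
theorem natCard_torsion_classGroup_eq_of_ringEquiv {E₁ E₂ : Type*} [Field E₁] [Field E₂] (e : E₁ ≃+* E₂) (q : ℕ) :
    Nat.card {d : ClassGroup (𝓞 E₁) // d ^ q = 1} = Nat.card {d : ClassGroup (𝓞 E₂) // d ^ q = 1} := by
  refine Nat.card_congr ((ClassGroup.mulEquiv (RingOfIntegers.mapRingEquiv e)).toEquiv.subtypeEquiv fun d => ?_)
  rw [MulEquiv.toEquiv_eq_coe, MulEquiv.coe_toEquiv, ← map_pow, MulEquiv.map_eq_one_iff]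

/-- `#Cl(E₁) = #Cl(E₂)` for isomorphic number fields. [folklore] -/
theorem natCard_classGroup_eq_of_ringEquiv {E₁ E₂ : Type*} [Field E₁] [Field E₂] (e : E₁ ≃+* E₂) :
    Nat.card (ClassGroup (𝓞 E₁)) = Nat.card (ClassGroup (𝓞 E₂)) :=
  Nat.card_congr (ClassGroup.mulEquiv (RingOfIntegers.mapRingEquiv e)).toEquiv

variable (F L : Type) [Field F] [NumberField F] [Field L] [NumberField L] [Algebra F L] [IsGalois F L]

/-- The fixed field of a generating `σ` is `⊥ ≅ F`: a ring isomorphism `L^{⟨σ⟩} ≃+* F`. [folklore] -/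
theorem nonempty_fixedField_zpowers_ringEquiv (σ : L ≃ₐ[F] L) (hgen : ∀ τ : L ≃ₐ[F] L, τ ∈ Subgroup.zpowers σ) :
    Nonempty (↥(fixedField (Subgroup.zpowers σ)) ≃+* F) := by
  haveI : FiniteDimensional F L := Module.Finite.of_restrictScalars_finite ℚ F L
  have htop : Subgroup.zpowers σ = ⊤ := by
    rw [eq_top_iff]
    intro τ _
    exact hgen τ
  have hbot : fixedField (Subgroup.zpowers σ) = (⊥ : IntermediateField F L) := by
    rw [htop, IsGalois.fixedField_top]
  exact ⟨((IntermediateField.equivOfEq hbot).trans (IntermediateField.botEquiv F L)).toRingEquiv⟩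

/-- **`#Cl(L)[q] = #Cl(F)[q] · #{c ∈ Cl(L)[q] : c·σc·σ²c = 1}`** for `L/F` Galois with `Gal(L/F) = ⟨σ⟩`, `σ³ = 1` (cyclic cubic or trivial) and
`gcd(3, q) = 1` («`#A(M_n)[2^N] = #A(K_n)[2^N] · #A_n^χ[2^N]`»). [folklore] -/
theorem card_torsion_classGroup_eq_card_base_mul_card_normKer (σ : L ≃ₐ[F] L) (hσ : σ ^ 3 = 1)
    (hgen : ∀ τ : L ≃ₐ[F] L, τ ∈ Subgroup.zpowers σ) {q : ℕ} (hq : Nat.Coprime 3 q) :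
    Nat.card {c : ClassGroup (𝓞 L) // c ^ q = 1} =
      Nat.card {d : ClassGroup (𝓞 F) // d ^ q = 1} *
        Nat.card {c : ClassGroup (𝓞 L) // c ^ q = 1 ∧
          c * ClassGroup.mulEquiv (AmbiguousClass.intAut σ) c *
            ClassGroup.mulEquiv (AmbiguousClass.intAut σ) (ClassGroup.mulEquiv (AmbiguousClass.intAut σ) c) = 1} := by
  obtain ⟨e⟩ := nonempty_fixedField_zpowers_ringEquiv F L σ hgen
  rw [← natCard_torsion_classGroup_eq_of_ringEquiv e q]
  exact card_torsion_classGroup_eq_card_fixedField_mul_card_normKer F L σ hσ hq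

/-- **`ord_p #Cl(L) = ord_p #Cl(F) + ord_p #A^χ[p^N]`** for `L/F` Galois with `Gal(L/F) = ⟨σ⟩`, `σ³ = 1`, `p ≠ 3` prime and `N` at least both `ord_p`'s
(«`e_n(M) = e_n(K) + ord₂ #A_n^χ`», the comparison input of `…GrowthComparison.classicalMuVanishes_of_comparison_with_base`). [folklore] -/
theorem padicValNat_card_classGroup_eq_base_add (σ : L ≃ₐ[F] L) (hσ : σ ^ 3 = 1)
    (hgen : ∀ τ : L ≃ₐ[F] L, τ ∈ Subgroup.zpowers σ) (p : ℕ) [Fact p.Prime] (hp3 : p ≠ 3) {N : ℕ}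
    (hNL : padicValNat p (Nat.card (ClassGroup (𝓞 L))) ≤ N) (hNF : padicValNat p (Nat.card (ClassGroup (𝓞 F))) ≤ N) :
    padicValNat p (Nat.card (ClassGroup (𝓞 L))) =
      padicValNat p (Nat.card (ClassGroup (𝓞 F))) +
        padicValNat p (Nat.card {c : ClassGroup (𝓞 L) // c ^ p ^ N = 1 ∧
          c * ClassGroup.mulEquiv (AmbiguousClass.intAut σ) c *
            ClassGroup.mulEquiv (AmbiguousClass.intAut σ) (ClassGroup.mulEquiv (AmbiguousClass.intAut σ) c) = 1}) := by
  obtain ⟨e⟩ := nonempty_fixedField_zpowers_ringEquiv F L σ hgen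
  have hF : Nat.card (ClassGroup (𝓞 ↥(fixedField (Subgroup.zpowers σ)))) = Nat.card (ClassGroup (𝓞 F)) :=
    natCard_classGroup_eq_of_ringEquiv e
  have h := padicValNat_card_classGroup_eq_add F L σ hσ p hp3 hNL (by rw [hF]; exact hNF)
  rw [hF] at h
  exact h

end Summit.BirchSwinnertonDyer.BirchSwinnertonDyer.Theorems.SignedMuAtTwo.NonsquareDescent
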